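import Literature.Probability.Percolation.RSW
import Literature.Probability.Percolation.LatticePathArcs
import Literature.Probability.Percolation.SiteConnectionTools
import Literature.Probability.LatticeModels.DomainDiscretisation
import Literature.Probability.LatticeModels.TriangularLattice
import Mathlib.Topology.Homeomorph.Defs
import Mathlib.Analysis.Complex.ReImTopology
import HarnessLib

/-!
# Plate crossing events in the coordinates of a planar chart

Topic `Literature/Probability/Percolation`; definitions (+ monotonicity), no named fact.

Schramm–Smirnov (*On the scaling limits of planar percolation*, Ann. Probab. 39 (2011), §1.3 and
§5) read crossings of a quad `Q₀` and of its perturbations `Q^q = Q̂₀([x₀,x₁] × [y₀,y₁])` through a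
plane homeomorphism `Q̂₀` extending the quad (in the tree: `IsSquareModel`, `perturbQuad`,
`QuadCrossingSquareModel.lean`).  For transfer arguments between two lattices one wants the same
events in a form that is (a) purely a lattice-path event (no continuum arcs, no largest component,
no tie rule), (b) monotone under enlarging the plate / shrinking the end zones by plain set
inclusion, and (c) available verbatim for bond-`ℤ²` primal paths, bond-`ℤ²` dual paths and
site-`𝕋` open/closed paths.  These are the **plate crossing events** of this file: given a chart
`Φ : ℂ ≃ₜ ℂ`, a drawing `draw : Site 2 → ℂ` of the lattice and plate parameters,

* `zdPlateV draw Φ x yin yout` — some open path of a bond configuration, all of whose vertices are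
  drawn in the plate `Φ([-x, x] × [-yout, yout])`, joins a vertex drawn in the lower zone
  `Φ{im ≤ -yin}` to a vertex drawn in the upper zone `Φ{yin ≤ im}` (a VERTICAL plate crossing);
  `zdPlateH draw Φ xin xout y` — the HORIZONTAL analogue (plate `Φ([-xout, xout] × [-y, y])`, zones
  `re ≤ -xin`, `xin ≤ re`);
* `dualDraw δ` — the drawing of the dual square lattice (face `f` at `δ f + δ(½, ½)`,
  `dualScale`), so that `dualConfig ⁻¹' zdPlateV (dualDraw δ) Φ …` is the dual-open plate crossing;
  `zdMonoPlateV/H Φ δ …` — primal-open OR dual-open ("monochromatic") plate crossings at mesh `δ`;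
* `triPlateV/H Φ δ …` — the site-`𝕋` open plate crossings (`siteConnIn triGraph`, sites drawn by
  `triMeshPoint δ`), `triMonoPlateV/H` — open OR closed.

Monotonicity (`zdPlateV_mono`, …): enlarging the plate and the zones enlarges the event.  In the
vertical direction "harder" means narrower plate, farther zones, lower plate; every comparison
"with room" between quads becomes an inequality between parameters.

## References

* O. Schramm, S. Smirnov, Ann. Probab. 39 (2011) 1768–1814, arXiv:1101.5820, §1.3, §5.
  [SchrammSmirnov2011]
* G. Grimmett, *Percolation*, 2nd ed. (1999), §11.3 (box crossings). [Grimmett1999]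
-/

noncomputable section

namespace Literature.Probability.Percolation

open Set Complex Literature.Probability.LatticeModels

/-- The closed coordinate box `[-x, x] × [-y, y] ⊆ ℂ`. [folklore] -/
def plateBox (x y : ℝ) : Set ℂ := Icc (-x) x ×ℂ Icc (-y) y

/-- `plateBox` is monotone in both half-sides. [folklore] -/
theorem plateBox_mono {x x' y y' : ℝ} (hx : x ≤ x') (hy : y ≤ y') : plateBox x y ⊆ plateBox x' y' :=
  fun _ hz => ⟨Icc_subset_Icc (neg_le_neg hx) hx hz.1, Icc_subset_Icc (neg_le_neg hy) hy hz.2⟩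

/-- The lower zones are nested. [folklore] -/
theorem zone_im_le_mono {yin yin' : ℝ} (h : yin' ≤ yin) : {z : ℂ | z.im ≤ -yin} ⊆ {z : ℂ | z.im ≤ -yin'} :=
  fun _ hz => le_trans hz (neg_le_neg h)

/-- The upper zones are nested. [folklore] -/
theorem zone_le_im_mono {yin yin' : ℝ} (h : yin' ≤ yin) : {z : ℂ | yin ≤ z.im} ⊆ {z : ℂ | yin' ≤ z.im} :=
  fun _ hz => le_trans h hz

/-- The left zones are nested. [folklore] -/
theorem zone_re_le_mono {xin xin' : ℝ} (h : xin' ≤ xin) : {z : ℂ | z.re ≤ -xin} ⊆ {z : ℂ | z.re ≤ -xin'} :=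
  fun _ hz => le_trans hz (neg_le_neg h)

/-- The right zones are nested. [folklore] -/
theorem zone_le_re_mono {xin xin' : ℝ} (h : xin' ≤ xin) : {z : ℂ | xin ≤ z.re} ⊆ {z : ℂ | xin' ≤ z.re} :=
  fun _ hz => le_trans h hz

/-- **Vertical plate crossing** of a bond configuration, read through the chart `Φ` and the
drawing `draw`: an open path drawn inside the plate `Φ(plateBox x yout)` from the zone
`Φ{im ≤ -yin}` to the zone `Φ{yin ≤ im}`. [cite: SchrammSmirnov2011, §1.3] -/
def zdPlateV (draw : Site 2 → ℂ) (Φ : ℂ ≃ₜ ℂ) (x yin yout : ℝ) : Set (BondConfig (Site 2)) :=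
  openCrossing {w | draw w ∈ Φ '' plateBox x yout} {w | draw w ∈ Φ '' {z | z.im ≤ -yin}}
    {w | draw w ∈ Φ '' {z | yin ≤ z.im}}

/-- **Horizontal plate crossing**: an open path drawn inside `Φ(plateBox xout y)` from the zone
`Φ{re ≤ -xin}` to the zone `Φ{xin ≤ re}`. [cite: SchrammSmirnov2011, §1.3] -/
def zdPlateH (draw : Site 2 → ℂ) (Φ : ℂ ≃ₜ ℂ) (xin xout y : ℝ) : Set (BondConfig (Site 2)) :=
  openCrossing {w | draw w ∈ Φ '' plateBox xout y} {w | draw w ∈ Φ '' {z | z.re ≤ -xin}}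
    {w | draw w ∈ Φ '' {z | xin ≤ z.re}}

/-- The drawing of the dual square lattice at mesh `δ`: the face with lower-left corner `f` is
drawn at `δ f + δ(½, ½)` (`dualScale`). [folklore] -/
def dualDraw (δ : ℝ) (f : Site 2) : ℂ := dualScale δ (Site.toComplex f)

/-- **Monochromatic vertical plate crossing on `ℤ²`** at mesh `δ`: a primal-open one, or a
dual-open one (of `dualConfig ω`, drawn by `dualDraw δ`). [folklore] -/
def zdMonoPlateV (Φ : ℂ ≃ₜ ℂ) (δ x yin yout : ℝ) : Set (BondConfig (Site 2)) :=
  zdPlateV (meshPoint δ) Φ x yin yout ∪ dualConfig ⁻¹' zdPlateV (dualDraw δ) Φ x yin yout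

/-- **Monochromatic horizontal plate crossing on `ℤ²`** at mesh `δ`. [folklore] -/
def zdMonoPlateH (Φ : ℂ ≃ₜ ℂ) (δ xin xout y : ℝ) : Set (BondConfig (Site 2)) :=
  zdPlateH (meshPoint δ) Φ xin xout y ∪ dualConfig ⁻¹' zdPlateH (dualDraw δ) Φ xin xout y

/-- **Vertical plate crossing of site percolation on `𝕋`** at mesh `δ` (open sites, `siteConnIn`;
sites drawn by `triMeshPoint δ`). [cite: SchrammSmirnov2011, §1.3] -/
def triPlateV (Φ : ℂ ≃ₜ ℂ) (δ x yin yout : ℝ) : Set (SiteConfig (Site 2)) :=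
  {ω | ∃ u ∈ {w : Site 2 | triMeshPoint δ w ∈ Φ '' {z | z.im ≤ -yin}},
    ∃ v ∈ {w : Site 2 | triMeshPoint δ w ∈ Φ '' {z | yin ≤ z.im}},
      ω ∈ siteConnIn triGraph {w | triMeshPoint δ w ∈ Φ '' plateBox x yout} u v}

/-- **Horizontal plate crossing of site percolation on `𝕋`** at mesh `δ`. [cite: SchrammSmirnov2011, §1.3] -/
def triPlateH (Φ : ℂ ≃ₜ ℂ) (δ xin xout y : ℝ) : Set (SiteConfig (Site 2)) :=
  {ω | ∃ u ∈ {w : Site 2 | triMeshPoint δ w ∈ Φ '' {z | z.re ≤ -xin}},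
    ∃ v ∈ {w : Site 2 | triMeshPoint δ w ∈ Φ '' {z | xin ≤ z.re}},
      ω ∈ siteConnIn triGraph {w | triMeshPoint δ w ∈ Φ '' plateBox xout y} u v}

/-- **Monochromatic vertical plate crossing on `𝕋`**: by open sites or by closed sites. [folklore] -/
def triMonoPlateV (Φ : ℂ ≃ₜ ℂ) (δ x yin yout : ℝ) : Set (SiteConfig (Site 2)) :=
  triPlateV Φ δ x yin yout ∪ compl ⁻¹' triPlateV Φ δ x yin yout

/-- **Monochromatic horizontal plate crossing on `𝕋`**. [folklore] -/
def triMonoPlateH (Φ : ℂ ≃ₜ ℂ) (δ xin xout y : ℝ) : Set (SiteConfig (Site 2)) :=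
  triPlateH Φ δ xin xout y ∪ compl ⁻¹' triPlateH Φ δ xin xout y

/-! ### Monotonicity -/

/-- **Harder vertical plates have smaller events**: narrower plate, farther zones, lower plate.
[folklore] -/
theorem zdPlateV_mono (draw : Site 2 → ℂ) (Φ : ℂ ≃ₜ ℂ) {x x' yin yin' yout yout' : ℝ}
    (hx : x ≤ x') (hyin : yin' ≤ yin) (hyout : yout ≤ yout') :
    zdPlateV draw Φ x yin yout ⊆ zdPlateV draw Φ x' yin' yout' := by
  refine openCrossing_mono ?_ ?_ ?_
  · exact fun w hw => image_mono (plateBox_mono hx hyout) hw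
  · exact fun w hw => image_mono (zone_im_le_mono hyin) hw
  · exact fun w hw => image_mono (zone_le_im_mono hyin) hw

/-- **Harder horizontal plates have smaller events**. [folklore] -/
theorem zdPlateH_mono (draw : Site 2 → ℂ) (Φ : ℂ ≃ₜ ℂ) {xin xin' xout xout' y y' : ℝ}
    (hxin : xin' ≤ xin) (hxout : xout ≤ xout') (hy : y ≤ y') :
    zdPlateH draw Φ xin xout y ⊆ zdPlateH draw Φ xin' xout' y' := by
  refine openCrossing_mono ?_ ?_ ?_
  · exact fun w hw => image_mono (plateBox_mono hxout hy) hw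
  · exact fun w hw => image_mono (zone_re_le_mono hxin) hw
  · exact fun w hw => image_mono (zone_le_re_mono hxin) hw

/-- **Harder vertical plates have smaller events** (`𝕋`). [folklore] -/
theorem triPlateV_mono (Φ : ℂ ≃ₜ ℂ) (δ : ℝ) {x x' yin yin' yout yout' : ℝ}
    (hx : x ≤ x') (hyin : yin' ≤ yin) (hyout : yout ≤ yout') :
    triPlateV Φ δ x yin yout ⊆ triPlateV Φ δ x' yin' yout' := by
  rintro ω ⟨u, hu, v, hv, hω⟩
  refine ⟨u, image_mono (zone_im_le_mono hyin) hu, v, image_mono (zone_le_im_mono hyin) hv, ?_⟩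
  exact siteConnIn_mono_set (G := triGraph) (S := {w | triMeshPoint δ w ∈ Φ '' plateBox x yout})
    (T := {w | triMeshPoint δ w ∈ Φ '' plateBox x' yout'})
    (fun w hw => (image_mono (plateBox_mono hx hyout) hw :)) u v hω

/-- **Harder horizontal plates have smaller events** (`𝕋`). [folklore] -/
theorem triPlateH_mono (Φ : ℂ ≃ₜ ℂ) (δ : ℝ) {xin xin' xout xout' y y' : ℝ}
    (hxin : xin' ≤ xin) (hxout : xout ≤ xout') (hy : y ≤ y') :
    triPlateH Φ δ xin xout y ⊆ triPlateH Φ δ xin' xout' y' := by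
  rintro ω ⟨u, hu, v, hv, hω⟩
  refine ⟨u, image_mono (zone_re_le_mono hxin) hu, v, image_mono (zone_le_re_mono hxin) hv, ?_⟩
  exact siteConnIn_mono_set (G := triGraph) (S := {w | triMeshPoint δ w ∈ Φ '' plateBox xout y})
    (T := {w | triMeshPoint δ w ∈ Φ '' plateBox xout' y'})
    (fun w hw => (image_mono (plateBox_mono hxout hy) hw :)) u v hω

/-- Monotonicity of the monochromatic vertical event on `ℤ²`. [folklore] -/
theorem zdMonoPlateV_mono (Φ : ℂ ≃ₜ ℂ) (δ : ℝ) {x x' yin yin' yout yout' : ℝ}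
    (hx : x ≤ x') (hyin : yin' ≤ yin) (hyout : yout ≤ yout') :
    zdMonoPlateV Φ δ x yin yout ⊆ zdMonoPlateV Φ δ x' yin' yout' :=
  union_subset_union (zdPlateV_mono _ Φ hx hyin hyout)
    (preimage_mono (zdPlateV_mono _ Φ hx hyin hyout))

/-- Monotonicity of the monochromatic horizontal event on `ℤ²`. [folklore] -/
theorem zdMonoPlateH_mono (Φ : ℂ ≃ₜ ℂ) (δ : ℝ) {xin xin' xout xout' y y' : ℝ}
    (hxin : xin' ≤ xin) (hxout : xout ≤ xout') (hy : y ≤ y') :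
    zdMonoPlateH Φ δ xin xout y ⊆ zdMonoPlateH Φ δ xin' xout' y' :=
  union_subset_union (zdPlateH_mono _ Φ hxin hxout hy)
    (preimage_mono (zdPlateH_mono _ Φ hxin hxout hy))

/-- Monotonicity of the monochromatic vertical event on `𝕋`. [folklore] -/
theorem triMonoPlateV_mono (Φ : ℂ ≃ₜ ℂ) (δ : ℝ) {x x' yin yin' yout yout' : ℝ}
    (hx : x ≤ x') (hyin : yin' ≤ yin) (hyout : yout ≤ yout') :
    triMonoPlateV Φ δ x yin yout ⊆ triMonoPlateV Φ δ x' yin' yout' :=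
  union_subset_union (triPlateV_mono Φ δ hx hyin hyout)
    (preimage_mono (triPlateV_mono Φ δ hx hyin hyout))

/-- Monotonicity of the monochromatic horizontal event on `𝕋`. [folklore] -/
theorem triMonoPlateH_mono (Φ : ℂ ≃ₜ ℂ) (δ : ℝ) {xin xin' xout xout' y y' : ℝ}
    (hxin : xin' ≤ xin) (hxout : xout ≤ xout') (hy : y ≤ y') :
    triMonoPlateH Φ δ xin xout y ⊆ triMonoPlateH Φ δ xin' xout' y' :=
  union_subset_union (triPlateH_mono Φ δ hxin hxout hy)
    (preimage_mono (triPlateH_mono Φ δ hxin hxout hy))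

end Literature.Probability.Percolation

end
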